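import Summits.CriticalPhenomena.PercolationContinuityZ3.Theorems.Transplant.SkelPhiCellsFineGeomT
import Summits.CriticalPhenomena.PercolationContinuityZ3.Theorems.Transplant.TwoAxisParaCellsFineRepQ
import HarnessLib

/-!
# WAVE-Q binder row Q35 «SkelPhiCellsFineGeomT» ↦ «SkelPhiCellsFineGeomTQ» (quasi-step rung (N3-b); table v0.7 level L3; captain/pen gen-1 g4): column vertices and the cell geometry of the fine skeleton (T cells) under (ι) := `Skelφ.QStepsN G φ M`

builds on p205010 (kernel theorem, internal audit signed; external expert review pending) — nothing in this file uses p205010; nothing here is a claim about any open node; no carrier,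
no node, no definition.  Lane `prim-bschramm`, seat `prim-bschramm-gen-1` (gen 4).  Helper file (`--supports stmt-CriticalPhenomena-4575 --as helper`).
Ported (the in-cone declarations of «SkelPhiCellsFineGeomT» that take the step hypothesis `(hstep : Steps G φ)`): `hcol_fineSkelT_q`, `geom_fineSkelT_q` — binder
`(hstep : Steps G φ) ↦ {M : ℕ} (hq : Skelφ.QStepsN G φ M)` (hunk (i)), LEVEL-0/lower-row calls swapped for their Q twins (hunk (ii)), graph-ball radii / window floors
multiplied by the cost `M` (hunk (iv)); every other binder and every proof line byte-identical; step-free residents of the module are imported, not copied.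
Floor row (p5-g28 reads): window floor `‖rep₂(cenS x)‖₁ + 1 ≤ R ↦ M·‖rep₂(cenS x)‖₁ + 1 ≤ R` in `hcol_fineSkelT_q` / `hcolQ` of `geom_fineSkelT_q` (same token as hp-8's `hcol_fineSkel_q`, row Q34).
-/

noncomputable section

open scoped Classical

namespace Summit.CriticalPhenomena.PercolationContinuityZ3.Theorems

namespace Transplant

namespace Skelφ

open Literature.Probability.Percolation Literature.Probability.LatticeModels SimpleGraph KNCells
open Literature.Probability.Percolation.KozmaNitzan
open Literature.Barriers.CriticalPhenomena (graphBall graphBall_finite mem_graphBall_self graphBall_mono)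
open BoxProdZ2 (ConcRadiiG)
open TwoAxis.Para (detD rep₂)

variable {V : Type} [DecidableEq V] {G : SimpleGraph V} [G.LocallyFinite] {φ : V → Site 2}

omit [DecidableEq V] in

/-- **The column vertex over the staggered centre**: a vertex `y` with `fineSkel … y = cenS x` inside the cube window `VWin ψ t (Q x) R` as soon as
`R ≥ ‖rep₂ (cenS x)‖₁ + 1` (the fine representative of `cenS x` and a weak-step neighbour, both in `Q x`). [this work] -/
theorem hcol_fineSkelT_q [DecidableEq V] (hlip : Lip G φ) {M : ℕ} (hq : QStepsN G φ M) (t : V) {A n h vα vβ c₀ c₁ : ℤ} (hc₀ : 0 < c₀) (hc₁ : 0 < c₁)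
    (hD : 0 < detD A n h vα vβ) (hL0 : c₀ * (|A| * (|vβ| + |vα|)) + 2 ≤ detD A n h vα vβ)
    (hL1 : c₁ * (|A| * (|n| + |h|)) + 2 ≤ detD A n h vα vβ) (P : PCells2T) (x : Site 2) {R : ℕ}
    (hR : M * ((rep₂ A n h vα vβ c₀ c₁ (PCells2T.cenS P x) 0).natAbs + (rep₂ A n h vα vβ c₀ c₁ (PCells2T.cenS P x) 1).natAbs) + 1 ≤ R) :
    ∃ y ∈ VWin G (fineSkel φ t A n h vα vβ c₀ c₁ (detD A n h vα vβ / 2) (detD A n h vα vβ / 2) (detD A n h vα vβ)) t (PCells2T.Q P x) R,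
      fineSkel φ t A n h vα vβ c₀ c₁ (detD A n h vα vβ / 2) (detD A n h vα vβ / 2) (detD A n h vα vβ) y = PCells2T.cenS P x := by
  obtain ⟨g, hg, hgz⟩ := exists_mem_graphBall_fineSkel_eq_q hq t hc₀ hc₁ hD hL0 hL1 (P.cenS x)
  have hlipψ : Lip G (fineSkel φ t A n h vα vβ c₀ c₁ (detD A n h vα vβ / 2) (detD A n h vα vβ / 2) (detD A n h vα vβ)) :=
    lip_fineSkel hlip t hc₀.le hc₁.le hD (by linarith) (by linarith)
  -- a weak-step neighbour stays in the cube `Q x` (its centre ± 1)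
  obtain ⟨m, hadj, -⟩ := weakSteps_fineSkel_of_qStepsN hq t hD hc₀.le hc₁.le (A := A) (n := n) (h := h) (vα := vα) (vβ := vβ)
    (s₀ := detD A n h vα vβ / 2) (s₁ := detD A n h vα vβ / 2) g 0 1
  have hQ : ∀ s : Site 2, (∀ i, |s i - P.cenS x i| ≤ 1) → s ∈ P.Q x := fun s hs => by
    rw [PCells2T.Q, PCells2T.mem_aboxS_iff]
    intro i
    have := abs_le.1 (hs i); have := P.one_le_r i
    push_cast; constructor <;> omega
  have hgQ : fineSkel φ t A n h vα vβ c₀ c₁ (detD A n h vα vβ / 2) (detD A n h vα vβ / 2) (detD A n h vα vβ) g ∈ P.Q x :=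
    hQ _ fun i => by rw [hgz]; simp
  have hmQ : fineSkel φ t A n h vα vβ c₀ c₁ (detD A n h vα vβ / 2) (detD A n h vα vβ / 2) (detD A n h vα vβ) m ∈ P.Q x :=
    hQ _ fun i => by
      have := hlipψ hadj i
      rw [hgz] at this
      rw [abs_sub_comm]; exact this
  exact ⟨g, mem_VWin_of_adj hg hR hgQ hadj hmQ, hgz⟩

/-- **THE SCHEME GEOMETRY OF THE FINE CELLS OVER STAGGERED CELLS**: at `ψ := fineSkel φ t A n h vα vβ c₀ c₁ (D/2) (D/2) D` (`D = det`), for staggered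
cells `P : PCells2T` and a schedule `Λ` with `WFS2 P.toPCells2 Λ` whose cube radii cover the fine column points over the staggered centres, the record
`cellGeomSG₂T G ψ P t Λ` (root `t`) has `Lip ψ` and all of `RunGeom/AnchGeom/SepGeom₂/ExitGeom/StepsGeom/LevelGeom/QSepGeom`.
[cite: KozmaNitzan2024, §4 pp. 25–31] -/
theorem geom_fineSkelT_q (hlip : Lip G φ) {M : ℕ} (hq : QStepsN G φ M) (t : V) {A n h vα vβ c₀ c₁ : ℤ} (hc₀ : 0 < c₀) (hc₁ : 0 < c₁)
    (hD : 0 < detD A n h vα vβ) (hL0 : c₀ * (|A| * (|vβ| + |vα|)) + 2 ≤ detD A n h vα vβ)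
    (hL1 : c₁ * (|A| * (|n| + |h|)) + 2 ≤ detD A n h vα vβ) (P : PCells2T) {Λ : ConcRadiiG} (hΛ : WFS2 P.toPCells2 Λ)
    (hcolQ : ∀ a x, M * ((rep₂ A n h vα vβ c₀ c₁ (PCells2T.cenS P x) 0).natAbs + (rep₂ A n h vα vβ c₀ c₁ (PCells2T.cenS P x) 1).natAbs) + 1 ≤ Λ.rQ a x) :
    let ψ := fineSkel φ t A n h vα vβ c₀ c₁ (detD A n h vα vβ / 2) (detD A n h vα vβ / 2) (detD A n h vα vβ)
    Lip G ψ ∧ RunGeom G (cellGeomSG₂T G ψ P t Λ) ∧ AnchGeom (cellGeomSG₂T G ψ P t Λ) ∧ SepGeom₂ G (cellGeomSG₂T G ψ P t Λ) ∧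
      ExitGeom G (cellGeomSG₂T G ψ P t Λ) ∧ StepsGeom (cellGeomSG₂T G ψ P t Λ) (faceDataSGT G ψ P t Λ) ∧
      LevelGeom G (cellGeomSG₂T G ψ P t Λ) (faceDataSGT G ψ P t Λ) (levelDataST ψ P) ∧ QSepGeom G (cellGeomSG₂T G ψ P t Λ) := by
  intro ψ
  have hlipψ : Lip G ψ := lip_fineSkel hlip t hc₀.le hc₁.le hD (by linarith) (by linarith)
  have hws : WeakSteps G ψ := weakSteps_fineSkel_of_qStepsN hq t hD hc₀.le hc₁.le
  have hψ0 : ψ t = 0 := by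
    have hD2 : 0 ≤ detD A n h vα vβ / 2 := Int.ediv_nonneg hD.le (by norm_num)
    have hD2' : detD A n h vα vβ / 2 < detD A n h vα vβ := by omega
    have h0 : TwoAxis.Para.coarse c₀ (detD A n h vα vβ / 2) (detD A n h vα vβ) 0 = 0 := by
      unfold TwoAxis.Para.coarse; rw [mul_zero, zero_add]; exact Int.ediv_eq_zero_of_lt hD2 hD2'
    have h1 : TwoAxis.Para.coarse c₁ (detD A n h vα vβ / 2) (detD A n h vα vβ) 0 = 0 := by
      unfold TwoAxis.Para.coarse; rw [mul_zero, zero_add]; exact Int.ediv_eq_zero_of_lt hD2 hD2'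
    have hrel : relφ φ t t = 0 := by funext i; simp [relφ]
    funext i
    fin_cases i
    · show ψ t 0 = 0
      simp only [ψ, fineSkel_apply_zero, hrel]; unfold TwoAxis.Para.lam0; simp [h0]
    · show ψ t 1 = 0
      simp only [ψ, fineSkel_apply_one, hrel]; unfold TwoAxis.Para.lam1 TwoAxis.Para.bp; simp [h1]
  have hcol : ∀ a x, ∃ y ∈ VWin G ψ t (PCells2T.Q P x) (Λ.rQ a x), ψ y = PCells2T.cenS P x := fun a x =>
    hcol_fineSkelT_q hlip hq t hc₀ hc₁ hD hL0 hL1 P x (hcolQ a x)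
  exact ⟨hlipψ, runGeomSG₂T P t, anchGeomSG₂T P t, sepGeom₂SG₂T P t hΛ hψ0 hlipψ hws hcol, exitGeomSG₂T P t hΛ hlipψ, stepsGeomSG₂T P t hΛ hlipψ hws,
    levelGeomSG₂T P t hΛ hlipψ, qSepGeomSG₂T P t hlipψ⟩

end Skelφ

end Transplant

end Summit.CriticalPhenomena.PercolationContinuityZ3.Theorems

end
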